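import Literature.NumberTheory.EllipticCurves.BurungaleKobayashiNakamuraOta2026.AnticyclotomicEllipticUnitClass
import Literature.NumberTheory.EllipticCurves.AnticyclotomicCompactSelmer
import Literature.NumberTheory.EllipticCurves.PointDivisibilityProofs
import HarnessLib

/-!
# Burungale–Kobayashi–Nakamura–Ota 2026 (arXiv:2608.06879v1, PREPRINT), §3.1.2, Def. 4.7, Thm. 7.2,
# §1.4: the LOCAL side of the bottom elliptic-unit class — the localisation `loc_𝔭` with torsion
# coefficients (X), the local Kummer compact group `E(K^{ac}_{n,𝔭}) ⊗ ℤ_p = H¹_f(K^{ac}_{n,𝔭}, T)` (Y),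
# and the two LOCAL INDEX EXPONENTS `λ₀` (of `𝒪 · loc_𝔭 z(𝟙)`) and `m_loc` (of `loc_𝔭(E(K) ⊗ ℤ_p)`)
# of the cell's ramified Rubin-formula dictionary — DEFINITIONS WITH BODIES + functoriality lemmas
# (PROVED); nothing asserted

Topic `NumberTheory/EllipticCurves`, sub-directory `BurungaleKobayashiNakamuraOta2026` (author–year;
namespace = path); sibling and consumer of `AnticyclotomicEllipticUnitClass.lean` (the datum
`EllipticUnitClassData`, its GLOBAL bottom index exponent `HasBottomIndexExp`). Cell `bsd-cm`
(run/shared/lean/pub/bsd-cm/), K7r route `route-BirchSwinnertonDyer-RamifiedSevenEllipticUnits`, item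
19143 → its VALUE child (planner D112 (c)/(e)/(f) 2026-08-26; seat `bsd-cm-ram` g7 sizing of the
Rubin-formula line, stubs (B4) "`λ₀(D) = c + m_loc`" and S_dict "`m_loc = n + n′`"; this file = the two
typed objects (X), (Y) those stubs need; seat `bsd-cm-k7r-c3` g5). HONEST STATUS: carriers and
definitions only; NO statement about any curve is asserted; the source is an unrefereed preprint
([claim: BurungaleKobayashiNakamuraOta2026, status: under-review]) and the index exponents are
DEFINITIONS OF THE CELL (the objects of [BKNO] §1.4's deferred "`p`-part BSD formula at ramified
primes", not printed statements).

## The printed statements (verbatim; `[BKNO]` = arXiv:2608.06879v1)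

* §3.1.2 (PDF p. 16): "`H¹_f(F_v, T ⊗ ℚ_p) = ker(H¹(F_v, T ⊗ ℚ_p) → H¹(F_v, T ⊗ B_cris))` (`v ∣ p`) […]
  `Sel_∙(F, M) = ker(H¹(F, M) → H¹(F_𝔭, M)/H¹_∙(F_𝔭, M) × ∏_{v ∤ p} H¹(F_v, M)/H¹_f(F_v, M))`" — the map
  `H¹(F, M) → H¹(F_𝔭, M)` is the localisation `loc_𝔭` (this file's (X), at finite level, `M = E[p^k]`).
* Def. 4.7 (PDF p. 27): "Fix a `Λ_ac`-basis `v_ε` of `H¹_ε(K_p, T^{⊗−1}(1) ⊗ Λ_ac)` and define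
  `ℒ_p(φ) := ℒ_{p,v_ε,t}(φ) ∈ Λ_ac` by `ℒ_{p,v_ε,t}(φ) · v_ε = loc_p(z^{t,ac}_{p^∞𝔣})`."
* Thm. 7.2 (= Thm. 1.8) (PDF p. 41): for `ε̂_p(Ind_{K/ℚ}(φχ)) = −ε`,
  "`χ(ℒ_{p,v_ε,t}(φ)) = exp*_ω(χ(v_{−ε})) · log_ω(χ(z^{t,ac}_{p^∞𝔣}))`"; Intro p. 7 (l.811–813): "For
  `k = 0`, the above Selmer classes are — granting the finiteness of the Tate–Shafarevich groups — the
  very classes producing the Mordell–Weil rank growth"; §1.4 (PDF p. 8): "The integral framework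
  developed in this paper lays the foundations for the ramified counterparts of these problems
  [`p`-part BSD formula], on which we will report elsewhere."
* Bloch–Kato 1990, Example 3.11: for an abelian variety `A/F_v`, `H¹_f(F_v, T_pA)` is the image of the
  Kummer map `A(F_v) ⊗ ℤ_p ↪ H¹(F_v, T_pA)`.  Perrin-Riou 1987 §0 (p. 401): `S_p(L) = lim←_k S(L)^{(p^k)}`
  inside `∏_k H¹(L, E[p^k])`, receiving `E(L) ⊗ ℤ_p` by the Kummer maps (the tree's `compactSelmerOver`,
  `kummerClassOver`, `IsKummerFamilyOver`).

## What the cell needs, and the transcription (SPECIAL CASE: finite layers, torsion coefficients)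

The K7r value line reads the ramified Rubin formula at `χ = 𝟙` as an identity of EXPONENTS:
`ord_π ℒ_{p,v_ε}(φ)(𝟙) = λ₀ := ord_π[E(K_𝔭) ⊗ ℤ_p : 𝒪 · loc_𝔭 z(𝟙)]` (Thm. 7.2 + the cell's derivation
that the bottom period `exp*_ω(v_{−ε}(𝟙))` is a unit), `λ₀ = c + m_loc` (index multiplicativity along
`𝒪 · z(𝟙) ⊆ E(K) ⊗ ℤ_p ⊆ E(K_𝔭) ⊗ ℤ_p`, `c` = the GLOBAL exponent `HasBottomIndexExp`), `m_loc = n + n′`.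
The GLOBAL side is typed in the sibling file; this file types the LOCAL side over the tree's objects:

**(T1) The local curve.** For `W : WeierstrassCurve K` (`K` any field) and a `K`-algebra `E` that is a
field (intended: `K` a number field, `E = K_𝔭 = 𝔭.adicCompletion K`), the geometric points of the local
curve `W_E := W.baseChange E` over the BASE FIELD `E` ARE the tree's `localPoints W E`
(`(W.baseChange E).baseChange K̄_E = W.baseChange K̄_E` definitionally), and the two `Γ_E`-actions agree
(`localPointsToGeomPoints_smul`; stated through the identity homomorphisms `localPointsToGeomPoints` /
`geomPointsToLocalPoints`, so that no instance is ever transported silently). Consequently the local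
torsion-coefficient cohomology, Kummer classes and Kummer families are simply the tree's
`torsionH1Over`, `kummerClassOver`, `IsKummerFamilyOver` of `W_E` over `E` — no second local theory.
**(T2) (X) = `localTorsionResOfEmb` / `localTorsionResPi`**: `loc_ι : H¹(H, E[m](K̄)) → H¹(H_E, E[m](K̄_E))`
for a `K`-embedding `ι : K̄ → K̄_E` and `H ≤ Γ_K` (`H_E = localSubgroupOfEmb H ι = Gal(K̄_E/L·E)`,
`L = K̄^H`), the map of the compatible pair `(H_E → H, ι_* : E[m](K̄) → E[m](K̄_E))` (`resH1Hom`) — the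
torsion-coefficient twin of the tree's `localResTorsionOverOfEmb` (coefficients `E(K̄_E)`), which
FACTORS through it (`localResTorsionOverOfEmb_eq_comp`, PROVED), commutes with `p_*`
(`localTorsionResOfEmb_reduceTorsionH1`, PROVED) and with `ℤ_p`-multiples (`localTorsionResPi_padicPi`),
and sends Kummer classes to Kummer classes (`localTorsionResOfEmb_kummerClassOver`, PROVED).
**(T3) (Y) = `localKummerCompactOfEmb`**: `E(L·E) ⊗ ℤ_p ⊆ ∏_k H¹(H_E, E[p^k](K̄_E))`, the `ℤ_p`-span
(`kummerSpan`, the INTEGRAL twin of the tree's `kummerRatSpan`; any base field) of the Kummer families of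
the `H_E`-fixed local points (`mordellWeilKummerSpan` of `W_E`) — Bloch–Kato's `H¹_f`, [BKNO]'s
`H¹_f(K^{ac}_{n,𝔭}, T)` at a finite layer.
**(T4) The exponents, as `Prop`s with the junk value audited (planner 13:03:38Z).**
`HasLocalIndexExpOfEmb ι x c`: `loc_ι(𝒪 · x) ⊆ E(L·E) ⊗ ℤ_p` (for `x` not Kummer at `ι` the predicate is
`False` for every `c`) AND `p^c = [E(L·E) ⊗ ℤ_p : tors + loc_ι(𝒪 · x)]` (`AddSubgroup.relIndex`; the
value `0` = infinite index is excluded by `= p^c`); `𝒪 · x` is the sibling file's `endSpan x`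
(`End_K(E)`-span, which makes the exponent `π`-adic for a CM curve over its CM field without choosing
a uniformiser).  `HasLocalMordellWeilIndexExpOfEmb ι m`: `p^m = [E(L·E) ⊗ ℤ_p : tors + loc_ι(E(L) ⊗ ℤ_p)]`
("π-free").  Both exponents are unique (`…_unique`, PROVED).  Part 4 specialises to [BKNO]'s bottom
layer (`H = Gal(K̄/K^{ac}_0)`, `E = K_𝔭`, the tree's chosen embedding `closureEmb`):
`EllipticUnitClassData.HasLocalBottomIndexExp D c` (= `λ₀(D)`, RELATIVE to the datum, datum-independent
over a shared `𝓔` by `z_eq`: `hasLocalBottomIndexExp_iff`, PROVED modulo the sibling's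
`CompactAcSelmerVanishes`) and `HasBottomLocalMordellWeilIndexExp W p K 𝔭 κ m` (= `m_loc`).
**(T5) NOT here, and why.** The identities S_B4 `λ₀ = c + m_loc` (index multiplicativity; hypotheses
`T_pШ(E/K) = 0`, `loc_𝔭` injective on `E(K) ⊗ ℤ_p / tors`) and S_dict `m_loc = n + n′` are STATEMENTS of
the K7r value line and are filed Summits-side as registered stubs, not as Literature facts; the
identification `λ₀ = ord_π ℒ_{p,v_ε}(φ)(𝟙)` needs `v_ε` / `exp*` on `H¹(K_𝔭, T ⊗ Λ_ac)` (absent, sibling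
(T4)); the inclusion `loc_ι(E(L) ⊗ ℤ_p) ⊆ E(L·E) ⊗ ℤ_p` at the level of Kummer SPANS is PROVED in
Part 5 (`map_localTorsionResPi_mordellWeilKummerSpan_le`, via the root-independence of `kummerClassOver`
and the transport of Kummer families `IsKummerFamilyOver.localTorsionResPi`).

## Main definitions and results (all `sorry`-free; no named fact introduced; net debt 0)

* Part 1 (`namespace WeierstrassCurve`, any field `K`, `K`-algebra field `E`, embedding `ι`):
  `localPointsToGeomPoints`, `geomPointsToLocalPoints` (+ `_smul`), `geomPointsMapOfEmb` (+ `_smul`,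
  `_injective`), `torsionPointsMapOfEmb`, **`localTorsionResOfEmb`** (X), `torsionToPointsH1`,
  `localResTorsionOverOfEmb_eq_comp`, `localTorsionResOfEmb_reduceTorsionH1`,
  `localTorsionResOfEmb_kummerClassOver`, **`localTorsionResPi`** (+ `_apply`, `_padicPi`).
* Part 2 (any field `F`): `fixedGeomPoints`, `kummerSpan` (+ `padicPi_mem_kummerSpan`, `kummerSpan_mono`),
  `mordellWeilKummerSpan`; **`localKummerCompactOfEmb`** (Y), `localEndSpanOfEmb`,
  **`HasLocalIndexExpOfEmb`**, **`HasLocalMordellWeilIndexExpOfEmb`** (+ uniqueness).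
* Part 4 (`namespace …BurungaleKobayashiNakamuraOta2026`): `HasBottomLocalMordellWeilIndexExp` (`m_loc`),
  `EllipticUnitClassData.HasLocalBottomIndexExp` (`λ₀(D)`), `hasLocalBottomIndexExp_iff`, uniqueness.
* Part 5 (PROVED transport): `kummerClassOver_eq_of_zsmul_eq` (root independence, any field),
  `IsKummerFamilyOver.localTorsionResPi`, `map_localTorsionResPi_kummerSpan_le`,
  `map_localTorsionResPi_mordellWeilKummerSpan_le` (`loc_ι(E(L) ⊗ ℤ_p) ⊆ E(L·E) ⊗ ℤ_p`).
* Part 6 (PROVED, any base field): `kummerClassOver_add`, `IsKummerFamilyOver.unique`,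
  `exists_isKummerFamilyOver`, `IsKummerFamilyOver.add`, `isKummerFamilyOver_zero`,
  `IsKummerFamilyOver.reduceTorsionH1` (Kummer families are `p`-compatible).
* Part 7 (PROVED, any base field): `kummerClassOver_eq_zero_of_fixed`, `kummerClassOver_eq_zero_iff`
  (Kummer injectivity `E(L')/m ↪ H¹(L', E[m])`), `kummerFamily` / `kummerFamilyHom` (the compact Kummer map
  as a homomorphism `fixedGeomPoints H' →+ torsionH1Pi`), `kummerFamily_apply_eq_zero_iff` (level-`k` kernel
  `= p^k E(L')`), `kummerSpan_eq_closure_kummerFamily`.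

## References

* [BurungaleKobayashiNakamuraOta2026] A. Burungale, S. Kobayashi, K. Nakamura, K. Ota, arXiv:2608.06879v1
  (2026): §3.1.2 (p. 16), §3.3.1 (p. 19), Def. 4.7 (p. 27), Lemma 5.2 (p. 33), Thm. 7.2 (p. 41),
  Thm. 1.8 and §1.4 (pp. 7–8).
* S. Bloch, K. Kato, *L-functions and Tamagawa numbers of motives* (1990), Example 3.11. [BlochKato1990]
* B. Perrin-Riou, Bull. SMF 115 (1987), §0 pp. 400–402 (compact Selmer groups). [PerrinRiou1987BSMF]
* B. Howard, Compos. Math. 140 (2004), §1 (descent sequence for `S_p(E/L)`). [Howard2004HeegnerKolyvagin]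
* R. Greenberg, LNM 1716 (1999), §2 (local conditions via embeddings). [GreenbergLNM1716]
* J.-P. Serre, *Galois Cohomology*, I.§2.4, II.§1.1 (functoriality; restriction to decomposition groups).
* J. H. Silverman, *AEC* (2009), VIII.§1–2, X.§4 (Galois action on points, Kummer sequence). [SilvermanAEC2009]
* Cell texts: `pub/bsd-cm/bsd-cm-ram/queue-g7/BETA-DESIGN-ram-g7.md` §7 (the exponents `λ₀`, `m_loc`,
  `ν₀ = 0`); STATUS 2026-08-26T12:58:18Z (sizing: (X), (Y), B4, S_dict); planner D112.
-/

noncomputable section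

open scoped Classical

open NumberField IsDedekindDomain Field
  Literature.NumberTheory.EllipticCurves Literature.NumberTheory.GaloisRepresentations

universe u

namespace WeierstrassCurve

variable {K : Type u} [Field K] (W : WeierstrassCurve K)
variable {E : Type u} [Field E] [Algebra K E] (ι : AlgebraicClosure K →ₐ[K] AlgebraicClosure E)

/-! ### The local curve `W_E = W.baseChange E`: its geometric points are the tree's local points -/

/-- The identity `E(K̄_E) → E_E(K̄_E)` from the tree's `localPoints W E` to the geometric points of the
local curve `W_E := W.baseChange E` over the base field `E` (the SAME type and group law:
`(W.baseChange E).baseChange K̄_E = W.baseChange K̄_E` definitionally), as an additive homomorphism —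
the device by which the local curve's own cohomology / Kummer theory (`torsionH1Over`,
`kummerClassOver`, `IsKummerFamilyOver` over the base field `E`) is applied to local points.
Silverman, *AEC*, VIII.§1. [folklore] -/
def localPointsToGeomPoints : localPoints W E →+ geomPoints (W.baseChange E) where
  toFun P := P
  map_zero' := rfl
  map_add' _ _ := rfl

/-- The inverse identity `E_E(K̄_E) → E(K̄_E)`. [folklore] -/
def geomPointsToLocalPoints : geomPoints (W.baseChange E) →+ localPoints W E where
  toFun P := P
  map_zero' := rfl
  map_add' _ _ := rfl

/-- `geomPointsToLocalPoints ∘ localPointsToGeomPoints = id` (pointwise). [cite: SilvermanAEC2009, VIII.§1 (points over extensions; plumbing identity)] -/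
@[simp]
theorem geomPointsToLocalPoints_localPointsToGeomPoints (P : localPoints W E) :
    W.geomPointsToLocalPoints (W.localPointsToGeomPoints (E := E) P) = P :=
  rfl

/-- `localPointsToGeomPoints ∘ geomPointsToLocalPoints = id` (pointwise). [cite: SilvermanAEC2009, VIII.§1 (points over extensions; plumbing identity)] -/
@[simp]
theorem localPointsToGeomPoints_geomPointsToLocalPoints (P : geomPoints (W.baseChange E)) :
    W.localPointsToGeomPoints (W.geomPointsToLocalPoints (E := E) P) = P :=
  rfl

/-- `localPointsToGeomPoints` is injective (it is the identity). [cite: SilvermanAEC2009, VIII.§1 (points over extensions; plumbing identity)] -/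
theorem localPointsToGeomPoints_injective :
    Function.Injective (W.localPointsToGeomPoints (E := E)) :=
  fun _ _ h ↦ h

/-- **The two `Γ_E`-actions agree**: the tree's action on `localPoints W E` (through
`restrictScalars K`, `localPoints.smul_def`) and the action on the geometric points of the local curve
`W_E` (base field `E`) both apply `σ` to the coordinates. Silverman, *AEC*, VIII.§1. [cite: SilvermanAEC2009, VIII.§1 (the Galois action on points)] [cite: SerreGaloisCohomology1997, II.§1.1] -/
theorem localPointsToGeomPoints_smul (σ : Field.absoluteGaloisGroup E) (P : localPoints W E) :
    W.localPointsToGeomPoints (σ • P) = σ • W.localPointsToGeomPoints (E := E) P := by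
  rcases P with _ | ⟨x, y, h⟩
  · rfl
  · rfl

/-- The same for the inverse identity. [cite: SilvermanAEC2009, VIII.§1 (the Galois action on points)] [cite: SerreGaloisCohomology1997, II.§1.1] -/
theorem geomPointsToLocalPoints_smul (σ : Field.absoluteGaloisGroup E)
    (P : geomPoints (W.baseChange E)) :
    W.geomPointsToLocalPoints (σ • P) = σ • W.geomPointsToLocalPoints (E := E) P := by
  rcases P with _ | ⟨x, y, h⟩
  · rfl
  · rfl

/-- `E(K̄) → E_E(K̄_E)` along a `K`-embedding `ι : K̄ → K̄_E`: the tree's `pointsMapOfEmb W ι`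
(`Affine.Point.map ι`) read in the geometric points of the local curve `W_E`. Silverman, *AEC*, X.§4. [folklore] -/
def geomPointsMapOfEmb : W.geomPoints →+ geomPoints (W.baseChange E) :=
  (W.localPointsToGeomPoints (E := E)).comp (pointsMapOfEmb W ι)

/-- Unfolding `geomPointsMapOfEmb`. [cite: SilvermanAEC2009, X.§4 (Remark 4.1.1)] -/
theorem geomPointsMapOfEmb_apply (P : W.geomPoints) :
    W.geomPointsMapOfEmb ι P = W.localPointsToGeomPoints (pointsMapOfEmb W ι P) :=
  rfl

/-- `geomPointsMapOfEmb ι` is injective (`ι` is). [cite: SilvermanAEC2009, X.§4 (Remark 4.1.1)] -/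
theorem geomPointsMapOfEmb_injective : Function.Injective (W.geomPointsMapOfEmb ι) :=
  (W.localPointsToGeomPoints_injective (E := E)).comp (pointsMapOfEmb_injective W ι)

/-- Equivariance of `geomPointsMapOfEmb ι` along `Γ_E → Γ_K`: `ι_*(τ|_{K̄} • P) = τ • ι_* P`
(the tree's `pointsMapOfEmb_smul`, transported by `localPointsToGeomPoints_smul`).
Serre, *Galois Cohomology*, II.§1.1. [cite: SerreGaloisCohomology1997, II.§1.1 (restriction to a decomposition group)] [cite: SilvermanAEC2009, X.§4 (Remark 4.1.1)] -/
theorem geomPointsMapOfEmb_smul (τ : Field.absoluteGaloisGroup E) (P : W.geomPoints) :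
    W.geomPointsMapOfEmb ι (resGalOfEmb ι τ • P) = τ • W.geomPointsMapOfEmb ι P := by
  rw [geomPointsMapOfEmb_apply, geomPointsMapOfEmb_apply, pointsMapOfEmb_smul W ι,
    localPointsToGeomPoints_smul]

/-! ### (X) The local restriction with TORSION coefficients -/

/-- `E[m](K̄) → E_E[m](K̄_E)` along `ι`: `geomPointsMapOfEmb ι` restricted to `m`-torsion.
Silverman, *AEC*, X.§4 and VIII.§1. [folklore] -/
def torsionPointsMapOfEmb (m : ℤ) : geomTorsion W m →+ geomTorsion (W.baseChange E) m :=
  ((W.geomPointsMapOfEmb ι).comp (geomTorsion W m).subtype).codRestrict (geomTorsion (W.baseChange E) m)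
    fun P ↦ by
      rw [mem_geomTorsion_iff, AddMonoidHom.coe_comp, Function.comp_apply, AddSubgroup.coe_subtype,
        ← map_zsmul, (mem_geomTorsion_iff W m (P : W.geomPoints)).1 P.2, map_zero]

/-- Values of `torsionPointsMapOfEmb`. [cite: SilvermanAEC2009, X.§4 (Remark 4.1.1)] -/
@[simp]
theorem coe_torsionPointsMapOfEmb (m : ℤ) (P : geomTorsion W m) :
    ((W.torsionPointsMapOfEmb ι m P : geomTorsion (W.baseChange E) m) : geomPoints (W.baseChange E)) =
      W.geomPointsMapOfEmb ι (P : W.geomPoints) :=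
  rfl

/-- **Local restriction with TORSION coefficients** attached to a `K`-embedding `ι : K̄ → K̄_E`:
`loc_ι : H¹(H, E[m](K̄)) → H¹(H_E, E[m](K̄_E))`, `H_E = localSubgroupOfEmb H ι = Gal(K̄_E/L·E)` for
`L = K̄^H` (the compatible pair `(H_E → H, E[m](K̄) → E[m](K̄_E))`), with values in the
torsion-coefficient cohomology `W_E.torsionH1Over m H_E` of the LOCAL curve `W_E = W.baseChange E`
over the base field `E` — the torsion-coefficient twin of the tree's `localResTorsionOverOfEmb`
(whose coefficients are the local POINTS `E(K̄_E)`; `localResTorsionOverOfEmb_eq_comp`).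
Serre, *Galois Cohomology*, II.§1.1; Milne, *ADT*, I.§6; Greenberg (1999) §2. [cite: GreenbergLNM1716, §2] -/
def localTorsionResOfEmb (m : ℤ) (H : Subgroup (Field.absoluteGaloisGroup K)) :
    W.torsionH1Over m H →+ (W.baseChange E).torsionH1Over m (localSubgroupOfEmb H ι) :=
  resH1Hom (resGalSubgroupOfEmb H ι) (W.torsionPointsMapOfEmb ι m) fun τ P ↦ Subtype.ext (by
    simp only [coe_torsionPointsMapOfEmb, Subgroup.smul_def, resGalSubgroupOfEmb_apply_coe,
      Literature.NumberTheory.EllipticCurves.AddSubgroup.torsionBy.coe_smul]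
    exact W.geomPointsMapOfEmb_smul ι τ P)

/-- The inclusion `E_E[m](K̄_E) ↪ E(K̄_E)` on `H¹`: `H¹(H', E[m](K̄_E)) → H¹(H', E(K̄_E))` (compatible
pair `(id, E[m] ⊆ E_E(K̄_E) = E(K̄_E))`), whose kernel is the local Kummer image (Kummer sequence).
Silverman, *AEC*, VIII.§2 and X.§4. [folklore] -/
def torsionToPointsH1 (m : ℤ) (H' : Subgroup (Field.absoluteGaloisGroup E)) :
    (W.baseChange E).torsionH1Over m H' →+ discreteH1 H' (localPoints W E) :=
  resH1Hom (ContinuousMonoidHom.id H')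
    ((W.geomPointsToLocalPoints (E := E)).comp (geomTorsion (W.baseChange E) m).subtype) fun τ P ↦ by
    change W.geomPointsToLocalPoints ((((τ : H') : Field.absoluteGaloisGroup E) • P :
        geomTorsion (W.baseChange E) m) : geomPoints (W.baseChange E)) = _
    rw [Literature.NumberTheory.EllipticCurves.AddSubgroup.torsionBy.coe_smul,
      geomPointsToLocalPoints_smul]
    rfl

/-- **The points-coefficient local restriction factors through the torsion-coefficient one**:
`localResTorsionOverOfEmb m H ι = torsionToPointsH1 ∘ localTorsionResOfEmb ι m H`
(`resH1Hom_comp`). Hence the tree's local Kummer condition at the place singled out by `ι` (the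
kernel of `localResTorsionOverOfEmb`) is the preimage under `loc_ι` of the local Kummer classes.
[cite: GreenbergLNM1716, §2] -/
theorem localResTorsionOverOfEmb_eq_comp (m : ℤ) (H : Subgroup (Field.absoluteGaloisGroup K)) :
    W.localResTorsionOverOfEmb m H ι =
      (W.torsionToPointsH1 m (localSubgroupOfEmb H ι)).comp (W.localTorsionResOfEmb ι m H) := by
  rw [torsionToPointsH1, localTorsionResOfEmb, resH1Hom_comp]
  rfl

/-- The torsion-coefficient local restriction commutes with the transition maps `p_*`
(`reduceTorsionH1`): both composites are the map of the compatible pair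
`(H_E → H, p • : E[p^{k+1}](K̄) → E[p^k](K̄_E))`. [cite: PerrinRiou1987BSMF, §0 p. 401] -/
theorem localTorsionResOfEmb_reduceTorsionH1 (p k : ℕ) (H : Subgroup (Field.absoluteGaloisGroup K))
    (x : W.torsionH1Over ((p : ℤ) ^ (k + 1)) H) :
    W.localTorsionResOfEmb ι ((p : ℤ) ^ k) H (W.reduceTorsionH1 p k H x) =
      (W.baseChange E).reduceTorsionH1 p k (localSubgroupOfEmb H ι)
        (W.localTorsionResOfEmb ι ((p : ℤ) ^ (k + 1)) H x) := by
  change ((W.localTorsionResOfEmb ι ((p : ℤ) ^ k) H).comp (W.reduceTorsionH1 p k H)) x =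
    (((W.baseChange E).reduceTorsionH1 p k (localSubgroupOfEmb H ι)).comp
      (W.localTorsionResOfEmb ι ((p : ℤ) ^ (k + 1)) H)) x
  rw [localTorsionResOfEmb, localTorsionResOfEmb, reduceTorsionH1, reduceTorsionH1, resH1Hom_comp,
    resH1Hom_comp]
  congr 1
  refine resH1Hom_congr rfl ?_ _ _
  ext P
  change W.geomPointsMapOfEmb ι ((p : ℤ) • (P : W.geomPoints)) =
    (p : ℤ) • W.geomPointsMapOfEmb ι (P : W.geomPoints)
  exact map_zsmul _ _ _

/-- For `Q ∈ E(K̄)` with `m • Q` fixed by `H`, the local point `m • ι_*Q` is fixed by `H_E`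
(equivariance of `ι_*` along `Γ_E → Γ_K`). [cite: SilvermanAEC2009, VIII.§2 (the Kummer sequence) and X.§4 (Remark 4.1.1)] -/
theorem smul_zsmul_geomPointsMapOfEmb (m : ℤ) (H : Subgroup (Field.absoluteGaloisGroup K))
    (Q : W.geomPoints) (hQ : ∀ σ ∈ H, σ • (m • Q) = m • Q) :
    ∀ τ ∈ localSubgroupOfEmb H ι,
      τ • (m • W.geomPointsMapOfEmb ι Q) = m • W.geomPointsMapOfEmb ι Q := fun τ hτ ↦ by
  rw [← map_zsmul, ← geomPointsMapOfEmb_smul, hQ _ ((mem_localSubgroupOfEmb_iff H ι τ).1 hτ)]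

/-- **Kummer classes restrict to Kummer classes**: for `Q ∈ E(K̄)` with `m • Q` fixed by `H`,
`loc_ι (δ_L(m • Q)) = δ_{L·E}(m • ι_*Q)`, the Kummer class over `H_E` of the local point `ι_* Q`
(both are the class of `τ ↦ τ•ι_*Q − ι_*Q`; `map_oneCocycleClass`). Silverman, *AEC*, VIII.§2 and
X.§4. [cite: SilvermanAEC2009, VIII.§2 (the Kummer pairing, Prop. 2.1 setting) and X.§4 (Remark 4.1.1)] -/
theorem localTorsionResOfEmb_kummerClassOver (m : ℤ) (H : Subgroup (Field.absoluteGaloisGroup K))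
    (Q : W.geomPoints) (hQ : ∀ σ ∈ H, σ • (m • Q) = m • Q) :
    W.localTorsionResOfEmb ι m H (W.kummerClassOver H m Q hQ) =
      (W.baseChange E).kummerClassOver (localSubgroupOfEmb H ι) m (W.geomPointsMapOfEmb ι Q)
        (W.smul_zsmul_geomPointsMapOfEmb ι m H Q hQ) := by
  rw [localTorsionResOfEmb, kummerClassOver, kummerClassOver]
  refine (map_oneCocycleClass (X := discreteTopRep H (geomTorsion W m))
    (Y := discreteTopRep (localSubgroupOfEmb H ι) (geomTorsion (W.baseChange E) m))
    (resGalSubgroupOfEmb H ι) (resHomOfEquivariant _ _ _) (W.kummerCocycleOver H m Q hQ)).trans ?_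
  congr 1
  refine Subtype.ext (ContinuousMap.ext fun τ ↦ Subtype.ext ?_)
  change W.geomPointsMapOfEmb ι ((resGalOfEmb ι τ) • Q - Q) = _
  rw [map_sub, geomPointsMapOfEmb_smul]
  rfl

/-! ### All levels at once -/

/-- `loc_ι` on families: `∏_k H¹(H, E[p^k](K̄)) → ∏_k H¹(H_E, E[p^k](K̄_E))`, componentwise
`localTorsionResOfEmb` — the localisation, at the place of `L = K̄^H` singled out by `ι`, of the
compact groups `S_p(E/L) ⊆ ∏_k H¹(L, E[p^k])` ([BKNO] §3–§4: `loc_𝔭 : H¹(K^{ac}_n, T) → H¹(K^{ac}_{n,𝔭}, T)`;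
Perrin-Riou 1987 §0). [cite: BurungaleKobayashiNakamuraOta2026, §3.1.2 and §4.4 (4.10) (arXiv:2608.06879 pp. 16, 31) (the localisation `loc_𝔭`; shape only)]
[cite: PerrinRiou1987BSMF, §0 p. 401] -/
def localTorsionResPi (p : ℕ) (H : Subgroup (Field.absoluteGaloisGroup K)) :
    W.torsionH1Pi p H →+ (W.baseChange E).torsionH1Pi p (localSubgroupOfEmb H ι) :=
  AddMonoidHom.pi fun k ↦
    (W.localTorsionResOfEmb ι ((p : ℤ) ^ k) H).comp
      (Pi.evalAddMonoidHom (fun j : ℕ ↦ W.torsionH1Over ((p : ℤ) ^ j) H) k)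

/-- Components of `localTorsionResPi`. [cite: PerrinRiou1987BSMF, §0 p. 401] -/
@[simp]
theorem localTorsionResPi_apply (p : ℕ) (H : Subgroup (Field.absoluteGaloisGroup K))
    (x : W.torsionH1Pi p H) (k : ℕ) :
    W.localTorsionResPi ι p H x k = W.localTorsionResOfEmb ι ((p : ℤ) ^ k) H (x k) :=
  rfl

/-- `loc_ι` commutes with the `ℤ_p`-action `padicPi` (componentwise `ℤ`-multiples). [cite: PerrinRiou1987BSMF, §0 p. 401 (the `ℤ_p`-module structure of `S_p(L)`)] -/
theorem localTorsionResPi_padicPi (p : ℕ) [Fact p.Prime] (H : Subgroup (Field.absoluteGaloisGroup K))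
    (c : ℤ_[p]) (x : W.torsionH1Pi p H) :
    W.localTorsionResPi ι p H (W.padicPi p H c x) =
      (W.baseChange E).padicPi p (localSubgroupOfEmb H ι) c (W.localTorsionResPi ι p H x) := by
  ext k
  simp only [localTorsionResPi_apply, padicPi, AddMonoidHom.pi_apply, AddMonoidHom.coe_comp,
    Function.comp_apply, Pi.evalAddMonoidHom_apply, zsmulAddGroupHom_apply, map_zsmul]


/-! ## Part 2. Kummer spans in the compact group `∏_k H¹(H, E[p^k])` (any base field) and the local
Kummer compact group `E(L·E) ⊗ ℤ_p` (Y) -/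

section KummerSpan

variable {F : Type u} [Field F] (V : WeierstrassCurve F) (p : ℕ) [Fact p.Prime]
  (H' : Subgroup (Field.absoluteGaloisGroup F))

/-- The points of `E(F̄)` fixed by `H' ≤ Γ_F` — the `L'`-rational points `E(L') = E(F̄)^{H'}`,
`L' = F̄^{H'}`, as an additive subgroup of the geometric points (Mathlib's `FixedPoints.addSubgroup`
for the action of the subgroup `H'`). Silverman, *AEC*, VIII.§1. [folklore] -/
def fixedGeomPoints : AddSubgroup (geomPoints V) :=
  FixedPoints.addSubgroup H' (geomPoints V)

variable {V H'} in
/-- Membership in `fixedGeomPoints`: fixed by every `σ ∈ H'`. [cite: SilvermanAEC2009, VIII.§1 (`E(L) = E(K̄)^{Gal(K̄/L)}`)] -/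
theorem mem_fixedGeomPoints_iff (P : geomPoints V) :
    P ∈ V.fixedGeomPoints H' ↔ ∀ σ ∈ H', σ • P = P := by
  rw [fixedGeomPoints, FixedPoints.mem_addSubgroup, Subtype.forall]
  rfl

/-- **The `ℤ_p`-span of the Kummer families of a set `S` of `H'`-fixed points**, as an additive
subgroup of `∏_k H¹(H', E[p^k])`: generated by the `c · d`, `c ∈ ℤ_p` (acting through the tree's
`padicPi`) and `d` a Kummer family (`IsKummerFamilyOver`) of some `P ∈ S` — the image of
`(ℤ S) ⊗ ℤ_p` under the compact Kummer map `E(L') ⊗ ℤ_p → S_p(E/L') ⊆ ∏_k H¹(L', E[p^k])`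
(Howard 2004 §1: "`0 → E(L) ⊗ ℤ_p → S_p(E/L) → lim← Ш_{p^n} → 0`"). The INTEGRAL twin of the tree's
`kummerRatSpan` (which is the `ℚ`-span of the same generators after `⊗ ℚ`); any base field `F`.
[cite: Howard2004HeegnerKolyvagin, §1 (descent sequence for S_p(E/L))] -/
def kummerSpan (S : Set (geomPoints V)) (hS : ∀ P ∈ S, ∀ σ ∈ H', σ • P = P) :
    AddSubgroup (V.torsionH1Pi p H') :=
  AddSubgroup.closure {x | ∃ (P : geomPoints V) (hPS : P ∈ S) (c : ℤ_[p]) (d : V.torsionH1Pi p H'),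
    V.IsKummerFamilyOver p H' (hS P hPS) d ∧ x = V.padicPi p H' c d}

/-- A `ℤ_p`-multiple of a Kummer family of a point of `S` lies in the Kummer span of `S`. [cite: Howard2004HeegnerKolyvagin, §1 (descent sequence for S_p(E/L))] -/
theorem padicPi_mem_kummerSpan {S : Set (geomPoints V)} (hS : ∀ P ∈ S, ∀ σ ∈ H', σ • P = P)
    {P : geomPoints V} (hP : P ∈ S) (c : ℤ_[p]) {d : V.torsionH1Pi p H'}
    (hd : V.IsKummerFamilyOver p H' (hS P hP) d) : V.padicPi p H' c d ∈ V.kummerSpan p H' S hS :=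
  AddSubgroup.subset_closure ⟨P, hP, c, d, hd, rfl⟩

/-- Monotonicity of `kummerSpan` in the set of points. [cite: Howard2004HeegnerKolyvagin, §1 (descent sequence for S_p(E/L))] -/
theorem kummerSpan_mono {S S' : Set (geomPoints V)} (hS' : ∀ P ∈ S', ∀ σ ∈ H', σ • P = P)
    (h : S ⊆ S') :
    V.kummerSpan p H' S (fun P hP ↦ hS' P (h hP)) ≤ V.kummerSpan p H' S' hS' := by
  refine AddSubgroup.closure_mono ?_
  rintro x ⟨P, hPS, c, d, hd, rfl⟩
  exact ⟨P, h hPS, c, d, hd, rfl⟩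

/-- **`E(L') ⊗ ℤ_p` in compact currency**: the `ℤ_p`-span of the Kummer families of ALL `H'`-fixed
points (`L' = F̄^{H'}`) inside `∏_k H¹(H', E[p^k])` — the image of the compact Kummer map
`E(L') ⊗ ℤ_p ↪ S_p(E/L')` (Howard 2004 §1; Perrin-Riou 1987 §0: "`E(D_n) ⊗ ℤ_p ↪ S_p(D_n)`"). For
`F` a LOCAL field `K_v` and `H' = Gal(K̄_v/L·K_v)` this is `E(L·K_v) ⊗ ℤ_p = lim←_k E(L·K_v)/p^k`
(Mattuck: `E(K_v) ≅ ℤ_p^{[K_v:ℚ_p]} × finite` for `v ∣ p`), i.e. Bloch–Kato's `H¹_f(L·K_v, T_pE)`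
(Ex. 3.11: for an abelian variety `H¹_f` is the Kummer image) — [BKNO]'s `H¹_f(K^{ac}_{n,𝔭}, T)` at a
finite layer. [cite: BlochKato1990, Example 3.11] [cite: Howard2004HeegnerKolyvagin, §1 (descent sequence for S_p(E/L))] -/
def mordellWeilKummerSpan : AddSubgroup (V.torsionH1Pi p H') :=
  V.kummerSpan p H' (V.fixedGeomPoints H' : Set (geomPoints V))
    fun P hP ↦ (V.mem_fixedGeomPoints_iff P).1 hP

end KummerSpan

section LocalKummer

variable (p : ℕ) (H : Subgroup (Field.absoluteGaloisGroup K))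

/-- **`loc_ι(𝒪 · x)`**: the image under the torsion-coefficient localisation `localTorsionResPi` of
the `End_K(E)`-span `endSpan x` of a family `x ∈ ∏_k H¹(H, E[p^k])` (for a CM curve over its CM
field: `𝒪_K · loc_𝔭 x`; [BKNO] §3.3.1 / Def. 4.7: the line `Λ_ac · loc_p z^{ac}` inside
`H¹(K_p, T ⊗ Λ_ac)`, read at a finite layer). [cite: BurungaleKobayashiNakamuraOta2026, §3.3.1 and Def. 4.7 (arXiv:2608.06879 pp. 19, 27) (shape only)] -/
def localEndSpanOfEmb (x : W.torsionH1Pi p H) :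
    AddSubgroup ((W.baseChange E).torsionH1Pi p (localSubgroupOfEmb H ι)) :=
  (W.endSpan p H x).map (W.localTorsionResPi ι p H)

/-- `loc_ι x ∈ loc_ι(𝒪 · x)`. [cite: BurungaleKobayashiNakamuraOta2026, §3.3.1 and Def. 4.7 (arXiv:2608.06879 pp. 19, 27) (shape only)] -/
theorem localTorsionResPi_mem_localEndSpanOfEmb (x : W.torsionH1Pi p H) :
    W.localTorsionResPi ι p H x ∈ W.localEndSpanOfEmb ι p H x :=
  ⟨x, W.self_mem_endSpan p H x, rfl⟩

variable [Fact p.Prime]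

/-- **(Y) The local Kummer compact group at the place singled out by `ι`**:
`E(L·E) ⊗ ℤ_p ⊆ ∏_k H¹(H_E, E[p^k](K̄_E))`, `H_E = localSubgroupOfEmb H ι = Gal(K̄_E/L·E)`, `L = K̄^H` —
the `mordellWeilKummerSpan` of the LOCAL curve `W_E = W.baseChange E` over the base field `E` for
the subgroup `H_E` (so: the `ℤ_p`-span of the Kummer families of the `L·E`-rational local points).
For `E = K_𝔭`, `H = Gal(K̄/K^{ac}_n)`: [BKNO]'s `H¹_f(K^{ac}_{n,𝔭}, T^{⊗−1}(1)) = E(K^{ac}_{n,𝔭}) ⊗ ℤ_p`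
(Bloch–Kato Ex. 3.11), the target lattice of the local indices `λ₀`, `m_loc` of the cell's
(★_an)-dictionary (K7r). [cite: BurungaleKobayashiNakamuraOta2026, §3.1.2 and Lemma 5.2 (arXiv:2608.06879 pp. 16, 33) (the local condition `H¹_f(K^{ac}_{n,p}, T)`; shape only)]
[cite: BlochKato1990, Example 3.11] -/
def localKummerCompactOfEmb :
    AddSubgroup ((W.baseChange E).torsionH1Pi p (localSubgroupOfEmb H ι)) :=
  (W.baseChange E).mordellWeilKummerSpan p (localSubgroupOfEmb H ι)

/-- **The LOCAL INDEX EXPONENT of a family `x` at the place singled out by `ι`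
(`HasLocalIndexExpOfEmb ι x c`): `loc_ι(𝒪 · x)` consists of local Kummer classes (lies in
`E(L·E) ⊗ ℤ_p`), and `p^c = [E(L·E) ⊗ ℤ_p : (E(L·E) ⊗ ℤ_p)_{tors} + 𝒪 · loc_ι x]`** — the relative
index (`AddSubgroup.relIndex`, i.e. the index of the intersection; `0` would mean infinite index, which
`= p^c` excludes) of the torsion plus `loc_ι(𝒪 · x)` inside the local Kummer compact group.  For the
cell's K7r dictionary (`E/ℚ` CM by `𝒪_K`, `p` ramified, `L = K`, `E = K_𝔭`, `E(K_𝔭) ⊗ ℤ_p ≅ 𝒪_𝔭`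
torsion-free of rank one): `c = ord_π [E(K_𝔭) ⊗ ℤ_p : 𝒪 · loc_𝔭 x]`, the `λ₀` of
`BETA-DESIGN-ram-g7.md` §7 (iv) when `x = z(𝟙)`; by [BKNO] Thm. 7.2 at `χ = 𝟙` and the unit bottom
period (`ν₀ = 0`, cell derivation) it is `ord_π ℒ_{p,v_ε}(φ)(𝟙)`.  A DEFINITION of the cell, junk-audited:
the first conjunct makes `c` the index of a genuine sublattice (for `x` not Kummer at `ι` the predicate
is `False` for every `c`), and `c` is unique (`hasLocalIndexExpOfEmb_unique`). NOT in print ([BKNO] §1.4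
"report elsewhere"). [cite: BurungaleKobayashiNakamuraOta2026, §1.4 and Thm. 7.2 (arXiv:2608.06879 pp. 8, 41) (claim; preprint; shape only — the object, not a statement)] -/
def HasLocalIndexExpOfEmb (x : W.torsionH1Pi p H) (c : ℕ) : Prop :=
  W.localEndSpanOfEmb ι p H x ≤ W.localKummerCompactOfEmb ι p H ∧
    (AddCommGroup.torsion ((W.baseChange E).torsionH1Pi p (localSubgroupOfEmb H ι)) ⊔
        W.localEndSpanOfEmb ι p H x).relIndex (W.localKummerCompactOfEmb ι p H) = p ^ c

/-- At most one local index exponent (`c ↦ p^c` is injective). [cite: BurungaleKobayashiNakamuraOta2026, §1.4 and Thm. 7.2 (arXiv:2608.06879 pp. 8, 41) (the bottom class; shape only)] -/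
theorem hasLocalIndexExpOfEmb_unique {x : W.torsionH1Pi p H} {c c' : ℕ}
    (hc : W.HasLocalIndexExpOfEmb ι p H x c) (hc' : W.HasLocalIndexExpOfEmb ι p H x c') : c = c' :=
  Nat.pow_right_injective (Fact.out : p.Prime).two_le (hc.2.symm.trans hc'.2)

/-- **The LOCAL MORDELL–WEIL INDEX EXPONENT at the place singled out by `ι`
(`HasLocalMordellWeilIndexExpOfEmb ι m`): `p^m = [E(L·E) ⊗ ℤ_p : (E(L·E) ⊗ ℤ_p)_{tors} + loc_ι(E(L) ⊗ ℤ_p)]`**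
— the relative index inside the local Kummer compact group of the torsion plus the localisation of the
GLOBAL Mordell–Weil Kummer span `mordellWeilKummerSpan` (`E(L) ⊗ ℤ_p`, `L = K̄^H`).  For the cell's K7r
dictionary (`L = K` the CM field, `E = K_𝔭`, `p` odd): `m = m_loc = log_p [E(K_𝔭) ⊗ ℤ_p : ℤ_p P ⊕ ℤ_p P']`
(`P`, `P'` generators of `E(ℚ)`, `E^{(d_K)}(ℚ)` modulo torsion) — "π-free", no CM action needed
(`BETA-DESIGN-ram-g7.md` §7, sizing 12:58Z); the intrinsic support statement S_dict of the K7r value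
line reads `m_loc = n + n'` (the `p`-adic levels of `P`, `P'` in `E(ℚ_p)`, `E'(ℚ_p)`). A DEFINITION of
the cell; `m` is unique (`hasLocalMordellWeilIndexExpOfEmb_unique`). [cite: BurungaleKobayashiNakamuraOta2026, §1.4 and Thm. 1.8 (arXiv:2608.06879 pp. 7–8) (claim; preprint; shape only — the object, not a statement)] -/
def HasLocalMordellWeilIndexExpOfEmb (m : ℕ) : Prop :=
  (AddCommGroup.torsion ((W.baseChange E).torsionH1Pi p (localSubgroupOfEmb H ι)) ⊔
      (W.mordellWeilKummerSpan p H).map (W.localTorsionResPi ι p H)).relIndex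
    (W.localKummerCompactOfEmb ι p H) = p ^ m

/-- At most one local Mordell–Weil index exponent. [cite: BurungaleKobayashiNakamuraOta2026, §1.4 and Thm. 1.8 (arXiv:2608.06879 pp. 7–8) (shape only)] -/
theorem hasLocalMordellWeilIndexExpOfEmb_unique {m m' : ℕ}
    (hm : W.HasLocalMordellWeilIndexExpOfEmb ι p H m) (hm' : W.HasLocalMordellWeilIndexExpOfEmb ι p H m') :
    m = m' :=
  Nat.pow_right_injective (Fact.out : p.Prime).two_le (hm.symm.trans hm')

end LocalKummer

end WeierstrassCurve

/-! ## Part 4. [BKNO] bottom layer: `λ₀(D)` and `m_loc` at the ramified prime `𝔭` -/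

namespace Literature.NumberTheory.EllipticCurves.BurungaleKobayashiNakamuraOta2026

open WeierstrassCurve

section Bottom

variable (W : WeierstrassCurve ℚ) (p : ℕ) [Fact p.Prime] (K : Type) [Field K] [NumberField K]
  (𝔭 : HeightOneSpectrum (𝓞 K)) (κ : ZpExtension K p)

/-- **`m_loc` — the bottom local Mordell–Weil index exponent at `𝔭`** (`HasBottomLocalMordellWeilIndexExp
W p K 𝔭 κ m`): `p^m = [E(K_𝔭) ⊗ ℤ_p : tors + loc_𝔭(E(K) ⊗ ℤ_p)]` at the bottom layer `K^{ac}_0 = K`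
(`κ.layerSubgroup 0 = Γ_K`) and the tree's chosen embedding `closureEmb (𝔭.adicCompletion K)` — the
instance `H = Gal(K̄/K^{ac}_0)`, `E = K_𝔭` of `HasLocalMordellWeilIndexExpOfEmb`. The cell's S_dict
(K7r value line, `Lines/rubin-formula.lean`): `m_loc = n + n'`. [cite: BurungaleKobayashiNakamuraOta2026, §1.4 and Thm. 1.8 (arXiv:2608.06879 pp. 7–8) (claim; preprint; shape only — the object, not a statement)] -/
def HasBottomLocalMordellWeilIndexExp (m : ℕ) : Prop :=
  (W.baseChange K).HasLocalMordellWeilIndexExpOfEmb (closureEmb (K := K) (𝔭.adicCompletion K)) p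
    (κ.layerSubgroup 0) m

variable {W p K 𝔭 κ} {γ : absoluteGaloisGroup K} {ι : PadicAlgCl p ≃+* ℂ} {φ : HeckeCharacter K}
  {Ω : ℂ} {𝓔 : AcDualExpSystem W p K 𝔭 κ ι}

namespace EllipticUnitClassData

variable [W.IsElliptic] (D : EllipticUnitClassData W p K 𝔭 κ γ ι φ Ω 𝓔)

/-- **`λ₀(D)` — the LOCAL index exponent of the bottom class at `𝔭`** (`D.HasLocalBottomIndexExp c`):
`loc_𝔭(𝒪 · z(𝟙))` consists of local Kummer classes and `p^c = [E(K_𝔭) ⊗ ℤ_p : tors + 𝒪 · loc_𝔭 z(𝟙)]`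
(the instance `x = D.z 0`, `H = Gal(K̄/K^{ac}_0)`, `E = K_𝔭`, chosen embedding, of
`HasLocalIndexExpOfEmb`). By [BKNO] Thm. 7.2 at `χ = 𝟙`, `ℒ_{p,v_ε}(φ)(𝟙) = exp*_ω(v_{−ε}(𝟙)) ·
log_ω(loc_𝔭 z(𝟙))`, and the cell's bottom-period derivation `ord exp*_ω(v_{−ε}(𝟙)) = 0`
(`BETA-DESIGN-ram-g7.md` §7, refereed PASS at derivation tier): `c = ord_π ℒ_{p,v_ε}(φ)(𝟙)`. RELATIVE
to the datum `D` (hence to `𝓔`), exactly like `HasBottomIndexExp`; the cell's S_B4 reads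
`λ₀(D) = c_bottom(D) + m_loc`. A DEFINITION of the cell; NOT in print (§1.4).
[cite: BurungaleKobayashiNakamuraOta2026, Thm. 7.2 and §1.4 (arXiv:2608.06879 pp. 8, 41) (claim; preprint; shape only — the object, not a statement)] -/
def HasLocalBottomIndexExp (c : ℕ) : Prop :=
  (W.baseChange K).HasLocalIndexExpOfEmb (closureEmb (K := K) (𝔭.adicCompletion K)) p
    (κ.layerSubgroup 0) (D.z 0) c

/-- At most one `λ₀(D)`. [cite: BurungaleKobayashiNakamuraOta2026, §1.4 and Thm. 7.2 (arXiv:2608.06879 pp. 8, 41) (the bottom class; shape only)] -/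
theorem hasLocalBottomIndexExp_unique {c c' : ℕ} (hc : D.HasLocalBottomIndexExp c)
    (hc' : D.HasLocalBottomIndexExp c') : c = c' :=
  (W.baseChange K).hasLocalIndexExpOfEmb_unique _ p _ hc hc'

/-- **`λ₀` is independent of the datum** (relative to `𝓔`): two data over the same `(ι, φ, Ω, 𝓔)` have
the same bottom class (`z_eq`, modulo `CompactAcSelmerVanishes` = [BKNO] Prop. 3.7 (3) + Lemma 5.2 and
the entire continuations), hence the same local index exponent. [cite: BurungaleKobayashiNakamuraOta2026, Prop. 3.7 (3) (arXiv:2608.06879 p. 19) (claim; preprint; shape only)] -/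
theorem hasLocalBottomIndexExp_iff (hS : CompactAcSelmerVanishes W p K κ γ)
    (hcont : ∀ χ : HeckeCharacter K, LFunction.HasEntireContinuation (heckeLFunction (φ * χ)))
    (D D' : EllipticUnitClassData W p K 𝔭 κ γ ι φ Ω 𝓔) (c : ℕ) :
    D.HasLocalBottomIndexExp c ↔ D'.HasLocalBottomIndexExp c := by
  unfold HasLocalBottomIndexExp
  rw [z_eq hS hcont D D' 0]

end EllipticUnitClassData

/-- At most one `m_loc`. [cite: BurungaleKobayashiNakamuraOta2026, §1.4 and Thm. 1.8 (arXiv:2608.06879 pp. 7–8) (shape only)] -/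
theorem hasBottomLocalMordellWeilIndexExp_unique {m m' : ℕ}
    (hm : HasBottomLocalMordellWeilIndexExp W p K 𝔭 κ m)
    (hm' : HasBottomLocalMordellWeilIndexExp W p K 𝔭 κ m') : m = m' :=
  (W.baseChange K).hasLocalMordellWeilIndexExpOfEmb_unique _ p _ hm hm'

end Bottom

end Literature.NumberTheory.EllipticCurves.BurungaleKobayashiNakamuraOta2026


/-! ## Part 5. Transport of Kummer classes, Kummer families and Kummer spans under `loc_ι` (PROVED;
seat `bsd-cm-k7r-c3` g5, second pass): the global Mordell–Weil span localises INTO the local Kummer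
compact group — the inclusion `loc_ι(E(L) ⊗ ℤ_p) ⊆ E(L·E) ⊗ ℤ_p` announced in (T5) -/

namespace WeierstrassCurve

section Transport

variable {F : Type u} [Field F] (V : WeierstrassCurve F)

/-- **The Kummer class does not depend on the chosen root**: if `m • Q = m • Q'` then
`δ(m • Q) = [σ ↦ σQ − Q] = [σ ↦ σQ' − Q']` in `H¹(H', E[m])` — the two cocycles differ by the coboundary
of the `m`-torsion point `Q − Q'` (`oneCocycleClass_eq_zero_iff`). Silverman, *AEC*, VIII.§2 (the Kummer
pairing is well defined). [cite: SilvermanAEC2009, VIII.§2 (Prop. 2.1 setting: the Kummer map is well defined)] -/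
theorem kummerClassOver_eq_of_zsmul_eq (H' : Subgroup (Field.absoluteGaloisGroup F)) (m : ℤ)
    (Q Q' : geomPoints V) (hQ : ∀ σ ∈ H', σ • (m • Q) = m • Q)
    (hQ' : ∀ σ ∈ H', σ • (m • Q') = m • Q') (h : m • Q = m • Q') :
    V.kummerClassOver H' m Q hQ = V.kummerClassOver H' m Q' hQ' := by
  rw [← sub_eq_zero, kummerClassOver, kummerClassOver,
    ← Literature.NumberTheory.GaloisRepresentations.oneCocycleClass_sub,
    Literature.NumberTheory.GaloisRepresentations.oneCocycleClass_eq_zero_iff]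
  have hT : Q - Q' ∈ geomTorsion V m := by
    rw [mem_geomTorsion_iff, zsmul_sub, h, sub_self]
  refine ⟨⟨Q - Q', hT⟩, fun σ ↦ Subtype.ext ?_⟩
  rw [Submodule.coe_sub, ContinuousMap.sub_apply, AddSubgroup.coe_sub, coe_kummerCocycleOver_apply,
    coe_kummerCocycleOver_apply]
  change ((σ : Field.absoluteGaloisGroup F) • Q - Q) - ((σ : Field.absoluteGaloisGroup F) • Q' - Q') =
    ((((σ : Field.absoluteGaloisGroup F) • (⟨Q - Q', hT⟩ : geomTorsion V m) : geomTorsion V m) :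
        geomPoints V)) - (Q - Q')
  rw [Literature.NumberTheory.EllipticCurves.AddSubgroup.torsionBy.coe_smul]
  change _ = (σ : Field.absoluteGaloisGroup F) • (Q - Q') - (Q - Q')
  rw [smul_sub]
  abel

end Transport

section TransportEmb

variable {K : Type u} [Field K] (W : WeierstrassCurve K)
variable {E : Type u} [Field E] [Algebra K E] (ι : AlgebraicClosure K →ₐ[K] AlgebraicClosure E)

/-- `ι_*` maps `H`-fixed points to `H_E`-fixed points (equivariance along `Γ_E → Γ_K`).
[cite: SerreGaloisCohomology1997, II.§1.1 (restriction to a decomposition group)] -/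
theorem smul_geomPointsMapOfEmb_of_fixed (H : Subgroup (Field.absoluteGaloisGroup K)) {P : W.geomPoints}
    (hP : ∀ σ ∈ H, σ • P = P) :
    ∀ τ ∈ localSubgroupOfEmb H ι, τ • W.geomPointsMapOfEmb ι P = W.geomPointsMapOfEmb ι P :=
  fun τ hτ ↦ by
    rw [← geomPointsMapOfEmb_smul, hP _ ((mem_localSubgroupOfEmb_iff H ι τ).1 hτ)]

/-- **Kummer FAMILIES restrict to Kummer families**: if `d = (δ_L(P))_k` is the Kummer family of the
`H`-fixed point `P` (`IsKummerFamilyOver`), then `loc_ι d` is the Kummer family of the local point `ι_* P`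
over `H_E` — for every local `p^k`-th root `Q'` of `ι_*P`, `loc_ι d_k = δ(Q')`: pick a global root `Q`
(`[p^k]` is onto on `E(K̄)`, `zsmul_geomPoints_surjective_holds`), transport its class
(`localTorsionResOfEmb_kummerClassOver`) and use root independence (`kummerClassOver_eq_of_zsmul_eq`).
[cite: Howard2004HeegnerKolyvagin, §1 (descent sequence for S_p(E/L))] [cite: SilvermanAEC2009, VIII.§2 and X.§4 (Remark 4.1.1)] -/
theorem IsKummerFamilyOver.localTorsionResPi [W.IsElliptic] (p : ℕ) [Fact p.Prime]
    (H : Subgroup (Field.absoluteGaloisGroup K)) {P : W.geomPoints} (hP : ∀ σ ∈ H, σ • P = P)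
    {d : W.torsionH1Pi p H} (hd : W.IsKummerFamilyOver p H hP d) :
    (W.baseChange E).IsKummerFamilyOver p (localSubgroupOfEmb H ι)
      (W.smul_geomPointsMapOfEmb_of_fixed ι H hP) (W.localTorsionResPi ι p H d) := by
  intro k Q' hQ'
  have hpk : ((p : ℤ) ^ k) ≠ 0 := pow_ne_zero _ (Int.natCast_ne_zero.mpr (Fact.out : p.Prime).ne_zero)
  obtain ⟨Q, hQ⟩ := W.zsmul_geomPoints_surjective_holds hpk P
  have hQ'' : ((p : ℤ) ^ k) • Q = P := hQ
  rw [localTorsionResPi_apply, hd k Q hQ'', localTorsionResOfEmb_kummerClassOver]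
  refine (W.baseChange E).kummerClassOver_eq_of_zsmul_eq _ _ _ _ _ _ ?_
  rw [← map_zsmul, hQ'', hQ']

/-- **Kummer SPANS localise into Kummer spans**: `loc_ι(kummerSpan S) ≤ kummerSpan (ι_* S)` for a set `S`
of `H`-fixed points (generators to generators: `loc_ι(c · d) = c · loc_ι d` and the previous lemma).
[cite: Howard2004HeegnerKolyvagin, §1 (descent sequence for S_p(E/L))] -/
theorem map_localTorsionResPi_kummerSpan_le [W.IsElliptic] (p : ℕ) [Fact p.Prime]
    (H : Subgroup (Field.absoluteGaloisGroup K)) (S : Set W.geomPoints)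
    (hS : ∀ P ∈ S, ∀ σ ∈ H, σ • P = P) :
    (W.kummerSpan p H S hS).map (W.localTorsionResPi ι p H) ≤
      (W.baseChange E).kummerSpan p (localSubgroupOfEmb H ι) (W.geomPointsMapOfEmb ι '' S)
        (by
          rintro _ ⟨P, hPS, rfl⟩
          exact W.smul_geomPointsMapOfEmb_of_fixed ι H (hS P hPS)) := by
  rw [kummerSpan, AddSubgroup.map_le_iff_le_comap, AddSubgroup.closure_le]
  rintro x ⟨P, hPS, c, d, hd, rfl⟩
  rw [SetLike.mem_coe, AddSubgroup.mem_comap, localTorsionResPi_padicPi]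
  exact (W.baseChange E).padicPi_mem_kummerSpan p (localSubgroupOfEmb H ι) _
    (Set.mem_image_of_mem (W.geomPointsMapOfEmb ι) hPS) c
    (IsKummerFamilyOver.localTorsionResPi W ι p H (hS P hPS) hd)

/-- **The global Mordell–Weil span localises INTO the local Kummer compact group**:
`loc_ι(E(L) ⊗ ℤ_p) ⊆ E(L·E) ⊗ ℤ_p` (`H`-fixed points go to `H_E`-fixed points) — the sanity inclusion
behind `HasLocalMordellWeilIndexExpOfEmb` (its relative index is the index of a genuine sublattice).
[cite: Howard2004HeegnerKolyvagin, §1 (descent sequence for S_p(E/L))] [cite: BlochKato1990, Example 3.11] -/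
theorem map_localTorsionResPi_mordellWeilKummerSpan_le [W.IsElliptic] (p : ℕ) [Fact p.Prime]
    (H : Subgroup (Field.absoluteGaloisGroup K)) :
    (W.mordellWeilKummerSpan p H).map (W.localTorsionResPi ι p H) ≤ W.localKummerCompactOfEmb ι p H := by
  unfold localKummerCompactOfEmb mordellWeilKummerSpan kummerSpan
  rw [AddSubgroup.map_le_iff_le_comap, AddSubgroup.closure_le]
  rintro x ⟨P, hPS, c, d, hd, rfl⟩
  rw [SetLike.mem_coe, AddSubgroup.mem_comap, localTorsionResPi_padicPi]
  refine AddSubgroup.subset_closure ⟨W.geomPointsMapOfEmb ι P, ?_, c, W.localTorsionResPi ι p H d,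
    IsKummerFamilyOver.localTorsionResPi W ι p H ((W.mem_fixedGeomPoints_iff P).1 hPS) hd, rfl⟩
  exact ((W.baseChange E).mem_fixedGeomPoints_iff _).2
    (W.smul_geomPointsMapOfEmb_of_fixed ι H ((W.mem_fixedGeomPoints_iff P).1 hPS))

end TransportEmb

end WeierstrassCurve


/-! ## Part 6. The Kummer family of a point: existence, uniqueness, additivity, `p`-compatibility
(PROVED; seat `bsd-cm-k7r-c3` g5) — the compact Kummer map `E(L') → ∏_k H¹(H', E[p^k])` is a
well-defined homomorphism into the compatible families (any base field; elliptic `V` for the root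
existence) — the API behind `kummerSpan` / `mordellWeilKummerSpan` / `localKummerCompactOfEmb` -/

namespace WeierstrassCurve

section KummerFamilyAPI

variable {F : Type u} [Field F] (V : WeierstrassCurve F) (p : ℕ) [Fact p.Prime]
  (H' : Subgroup (Field.absoluteGaloisGroup F))

/-- **The Kummer class is additive in the root**: `δ(m•(Q + Q')) = δ(m•Q) + δ(m•Q')`
(`σ(Q+Q') − (Q+Q') = (σQ − Q) + (σQ' − Q')`). [cite: SilvermanAEC2009, VIII.§2 (the Kummer pairing is bilinear)] -/
theorem kummerClassOver_add (m : ℤ) (Q Q' : geomPoints V) (hQ : ∀ σ ∈ H', σ • (m • Q) = m • Q)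
    (hQ' : ∀ σ ∈ H', σ • (m • Q') = m • Q') :
    V.kummerClassOver H' m (Q + Q') (fun σ hσ ↦ by rw [zsmul_add, smul_add, hQ σ hσ, hQ' σ hσ]) =
      V.kummerClassOver H' m Q hQ + V.kummerClassOver H' m Q' hQ' := by
  rw [kummerClassOver, kummerClassOver, kummerClassOver,
    ← Literature.NumberTheory.GaloisRepresentations.oneCocycleClass_add]
  congr 1
  refine Subtype.ext (ContinuousMap.ext fun σ ↦ Subtype.ext ?_)
  rw [Submodule.coe_add, ContinuousMap.add_apply, AddSubgroup.coe_add, coe_kummerCocycleOver_apply,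
    coe_kummerCocycleOver_apply, coe_kummerCocycleOver_apply, smul_add]
  abel

variable {V H'}

/-- **Uniqueness of the Kummer family** of an `H'`-fixed point (roots exist in `E(F̄)` for an
elliptic curve, `zsmul_geomPoints_surjective_holds`). [cite: Howard2004HeegnerKolyvagin, §1 (descent sequence for S_p(E/L))] -/
theorem IsKummerFamilyOver.unique [V.IsElliptic] {P : geomPoints V} {hP : ∀ σ ∈ H', σ • P = P}
    {d d' : V.torsionH1Pi p H'} (hd : V.IsKummerFamilyOver p H' hP d)
    (hd' : V.IsKummerFamilyOver p H' hP d') : d = d' := by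
  funext k
  have hpk : ((p : ℤ) ^ k) ≠ 0 := pow_ne_zero _ (Int.natCast_ne_zero.mpr (Fact.out : p.Prime).ne_zero)
  obtain ⟨Q, hQ⟩ := V.zsmul_geomPoints_surjective_holds hpk P
  rw [hd k Q hQ, hd' k Q hQ]

variable (V H') in
/-- **Existence of the Kummer family** of an `H'`-fixed point: choose a `p^k`-th root `Q_k` of `P` for
every `k` (`[p^k]` is onto on `E(F̄)`) and take `d_k = δ(p^k • Q_k)`; root independence
(`kummerClassOver_eq_of_zsmul_eq`) gives the defining property for every other root.
[cite: Howard2004HeegnerKolyvagin, §1 (descent sequence for S_p(E/L))] -/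
theorem exists_isKummerFamilyOver [V.IsElliptic] (P : geomPoints V) (hP : ∀ σ ∈ H', σ • P = P) :
    ∃ d : V.torsionH1Pi p H', V.IsKummerFamilyOver p H' hP d := by
  have hpk : ∀ k : ℕ, ((p : ℤ) ^ k) ≠ 0 := fun k ↦
    pow_ne_zero _ (Int.natCast_ne_zero.mpr (Fact.out : p.Prime).ne_zero)
  choose Q hQ using fun k ↦ V.zsmul_geomPoints_surjective_holds (hpk k) P
  refine ⟨fun k ↦ V.kummerClassOver H' ((p : ℤ) ^ k) (Q k) (fun σ hσ ↦ by
    rw [show ((p : ℤ) ^ k) • Q k = P from hQ k]; exact hP σ hσ), fun k Q' hQ' ↦ ?_⟩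
  exact V.kummerClassOver_eq_of_zsmul_eq H' _ _ _ _ _ ((hQ k).trans hQ'.symm)

/-- **Additivity of Kummer families**: if `d`, `d'` are the Kummer families of `P`, `P'`, then `d + d'`
is the Kummer family of `P + P'` (the compact Kummer map `E(L') → ∏_k H¹(H', E[p^k])` is a
homomorphism). [cite: Howard2004HeegnerKolyvagin, §1 (descent sequence for S_p(E/L))] [cite: SilvermanAEC2009, VIII.§2] -/
theorem IsKummerFamilyOver.add [V.IsElliptic] {P P' : geomPoints V} {hP : ∀ σ ∈ H', σ • P = P}
    {hP' : ∀ σ ∈ H', σ • P' = P'} {d d' : V.torsionH1Pi p H'} (hd : V.IsKummerFamilyOver p H' hP d)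
    (hd' : V.IsKummerFamilyOver p H' hP' d') :
    V.IsKummerFamilyOver p H' (P := P + P')
      (fun σ hσ ↦ by rw [smul_add, hP σ hσ, hP' σ hσ]) (d + d') := by
  intro k R hR
  have hpk : ((p : ℤ) ^ k) ≠ 0 := pow_ne_zero _ (Int.natCast_ne_zero.mpr (Fact.out : p.Prime).ne_zero)
  obtain ⟨Q, hQ⟩ := V.zsmul_geomPoints_surjective_holds hpk P
  obtain ⟨Q', hQ'⟩ := V.zsmul_geomPoints_surjective_holds hpk P'
  have hQQ' : ((p : ℤ) ^ k) • (Q + Q') = P + P' := by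
    rw [zsmul_add, show ((p : ℤ) ^ k) • Q = P from hQ, show ((p : ℤ) ^ k) • Q' = P' from hQ']
  rw [Pi.add_apply, hd k Q hQ, hd' k Q' hQ']
  exact (V.kummerClassOver_add H' _ Q Q' _ _).symm.trans
    (V.kummerClassOver_eq_of_zsmul_eq H' _ _ _ _ _ (hQQ'.trans hR.symm))

omit [Fact p.Prime] in
/-- The Kummer family of `0` is `0`. [cite: SilvermanAEC2009, VIII.§2] -/
theorem isKummerFamilyOver_zero [V.IsElliptic] :
    V.IsKummerFamilyOver p H' (P := 0) (fun σ _ ↦ smul_zero σ) 0 := by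
  intro k Q hQ
  rw [Pi.zero_apply]
  have h0 : V.kummerClassOver H' ((p : ℤ) ^ k) 0 (fun σ _ ↦ by rw [zsmul_zero, smul_zero]) = 0 := by
    rw [kummerClassOver, ← Literature.NumberTheory.GaloisRepresentations.oneCocycleClass_zero]
    congr 1
  rw [← h0]
  exact V.kummerClassOver_eq_of_zsmul_eq H' _ _ _ _ _ (by rw [zsmul_zero]; exact hQ.symm)

/-- **Kummer families are `p`-compatible**: `p_* d_{k+1} = d_k` (`p • Q_{k+1}` is a `p^k`-th root when
`Q_{k+1}` is a `p^{k+1}`-th root; the transition map `reduceTorsionH1` is induced by `p •`). Hence Kummer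
families lie in the compatible part of `∏_k H¹(H', E[p^k])` (Perrin-Riou's `S_p(L)` transition maps).
[cite: PerrinRiou1987BSMF, §0 p. 401] -/
theorem IsKummerFamilyOver.reduceTorsionH1 [V.IsElliptic] {P : geomPoints V}
    {hP : ∀ σ ∈ H', σ • P = P} {d : V.torsionH1Pi p H'} (hd : V.IsKummerFamilyOver p H' hP d) (k : ℕ) :
    V.reduceTorsionH1 p k H' (d (k + 1)) = d k := by
  have hpk : ((p : ℤ) ^ (k + 1)) ≠ 0 :=
    pow_ne_zero _ (Int.natCast_ne_zero.mpr (Fact.out : p.Prime).ne_zero)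
  obtain ⟨Q, hQ⟩ := V.zsmul_geomPoints_surjective_holds hpk P
  have hQ1 : ((p : ℤ) ^ (k + 1)) • Q = P := hQ
  have hpQ : ((p : ℤ) ^ k) • ((p : ℤ) • Q) = P := by rw [smul_smul, ← pow_succ, hQ1]
  rw [hd (k + 1) Q hQ1, hd k ((p : ℤ) • Q) hpQ, kummerClassOver, kummerClassOver,
    WeierstrassCurve.reduceTorsionH1]
  refine (map_oneCocycleClass (X := discreteTopRep H' (geomTorsion V ((p : ℤ) ^ (k + 1))))
    (Y := discreteTopRep H' (geomTorsion V ((p : ℤ) ^ k))) (ContinuousMonoidHom.id H')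
    (resHomOfEquivariant _ _ _) (V.kummerCocycleOver H' _ Q _)).trans ?_
  congr 1
  refine Subtype.ext (ContinuousMap.ext fun σ ↦ Subtype.ext ?_)
  change (p : ℤ) • ((σ : Field.absoluteGaloisGroup F) • Q - Q) = (σ : Field.absoluteGaloisGroup F) • ((p : ℤ) • Q) - (p : ℤ) • Q
  rw [smul_zsmul_geomPoints, zsmul_sub]

end KummerFamilyAPI

end WeierstrassCurve


/-! ## Part 7. The compact Kummer map as a homomorphism and Kummer injectivity (PROVED; seat
`bsd-cm-k7r-c3` g5): `kummerFamilyHom : E(L') →+ ∏_k H¹(H', E[p^k])`, its level-`k` kernel `p^k E(L')`,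
and `kummerSpan` as the `ℤ_p`-span of the `kummerFamily P` — lemmas L1/L2 of the S_dict plan
(crux 19705, `STUB-PLAN-stub_localMordellWeilDictSeven.md`) -/

namespace WeierstrassCurve

section KummerFamilyHom

variable {F : Type u} [Field F] (V : WeierstrassCurve F) (p : ℕ) [Fact p.Prime]
  (H' : Subgroup (Field.absoluteGaloisGroup F))

omit [Fact p.Prime] in
/-- **The Kummer class of a FIXED point vanishes**: if `Q` itself is `H'`-fixed then
`δ(m • Q) = [σ ↦ σQ − Q] = 0`. [cite: SilvermanAEC2009, VIII.§2 (the Kummer map kills `mE(K)`)] -/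
theorem kummerClassOver_eq_zero_of_fixed (m : ℤ) (Q : geomPoints V) (hQfix : ∀ σ ∈ H', σ • Q = Q) :
    V.kummerClassOver H' m Q (fun σ hσ ↦ by rw [smul_zsmul_geomPoints, hQfix σ hσ]) = 0 := by
  rw [kummerClassOver, Literature.NumberTheory.GaloisRepresentations.oneCocycleClass_eq_zero_iff]
  refine ⟨0, fun σ ↦ Subtype.ext ?_⟩
  rw [coe_kummerCocycleOver_apply, map_zero, sub_zero, Subgroup.smul_def, hQfix _ σ.2, sub_self]
  rfl

omit [Fact p.Prime] in
/-- **Kummer injectivity at one level** (`E(L')/m ↪ H¹(L', E[m])`): for `Q ∈ E(F̄)` with `m • Q`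
fixed by `H'`, the class `δ(m • Q)` vanishes iff `m • Q = m • R` for some `H'`-FIXED `R`, i.e. iff
`m • Q ∈ m • E(L')` (→: a trivialising `T ∈ E[m]` makes `Q − T` fixed; ←: root independence and the
previous lemma). Silverman, *AEC*, VIII.§2 (exactness of `0 → E(K)/mE(K) → H¹(K, E[m])`).
[cite: SilvermanAEC2009, VIII.§2 (the Kummer sequence, Prop. 2.1 setting)] -/
theorem kummerClassOver_eq_zero_iff (m : ℤ) (Q : geomPoints V) (hQ : ∀ σ ∈ H', σ • (m • Q) = m • Q) :
    V.kummerClassOver H' m Q hQ = 0 ↔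
      ∃ R : geomPoints V, (∀ σ ∈ H', σ • R = R) ∧ m • R = m • Q := by
  constructor
  · intro h
    rw [kummerClassOver, Literature.NumberTheory.GaloisRepresentations.oneCocycleClass_eq_zero_iff] at h
    obtain ⟨T, hT⟩ := h
    refine ⟨Q - (T : geomPoints V), fun σ hσ ↦ ?_, ?_⟩
    · have h1 := congrArg (fun x : geomTorsion V m ↦ (x : geomPoints V)) (hT ⟨σ, hσ⟩)
      simp only [AddSubgroup.coe_sub] at h1
      change (σ • Q - Q : geomPoints V) =
        (((σ • T : geomTorsion V m)) : geomPoints V) - (T : geomPoints V) at h1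
      rw [Literature.NumberTheory.EllipticCurves.AddSubgroup.torsionBy.coe_smul] at h1
      rw [smul_sub, sub_eq_sub_iff_sub_eq_sub.mp h1]
    · rw [zsmul_sub, (mem_geomTorsion_iff V m (T : geomPoints V)).1 T.2, sub_zero]
  · rintro ⟨R, hRfix, hR⟩
    rw [V.kummerClassOver_eq_of_zsmul_eq H' m Q R hQ
      (fun σ hσ ↦ by rw [smul_zsmul_geomPoints, hRfix σ hσ]) hR.symm]
    exact V.kummerClassOver_eq_zero_of_fixed H' m R hRfix

/-- Every `H'`-fixed point has a Kummer family (`exists_isKummerFamilyOver` on the subgroup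
`fixedGeomPoints`). [cite: Howard2004HeegnerKolyvagin, §1 (descent sequence for S_p(E/L))] -/
theorem exists_isKummerFamilyOver_fixed [V.IsElliptic] (P : V.fixedGeomPoints H') :
    ∃ d : V.torsionH1Pi p H', V.IsKummerFamilyOver p H' ((V.mem_fixedGeomPoints_iff _).1 P.2) d :=
  V.exists_isKummerFamilyOver p H' (P : geomPoints V) _

/-- **The Kummer family of an `H'`-fixed point** (a choice, pinned down by `IsKummerFamilyOver.unique`).
[cite: Howard2004HeegnerKolyvagin, §1 (descent sequence for S_p(E/L))] -/
def kummerFamily [V.IsElliptic] (P : V.fixedGeomPoints H') : V.torsionH1Pi p H' :=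
  Classical.choose (V.exists_isKummerFamilyOver_fixed p H' P)

/-- The defining property: `kummerFamily P` IS the Kummer family of `P`. [cite: Howard2004HeegnerKolyvagin, §1 (descent sequence for S_p(E/L))] -/
theorem isKummerFamilyOver_kummerFamily [V.IsElliptic] (P : V.fixedGeomPoints H') :
    V.IsKummerFamilyOver p H' ((V.mem_fixedGeomPoints_iff _).1 P.2) (V.kummerFamily p H' P) :=
  Classical.choose_spec (V.exists_isKummerFamilyOver_fixed p H' P)

variable {V H'} in
/-- Any Kummer family of `P` is `kummerFamily P` (uniqueness). [cite: Howard2004HeegnerKolyvagin, §1 (descent sequence for S_p(E/L))] -/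
theorem IsKummerFamilyOver.eq_kummerFamily [V.IsElliptic] {P : geomPoints V}
    (hP : ∀ σ ∈ H', σ • P = P) {d : V.torsionH1Pi p H'} (hd : V.IsKummerFamilyOver p H' hP d) :
    d = V.kummerFamily p H' ⟨P, (V.mem_fixedGeomPoints_iff P).2 hP⟩ :=
  IsKummerFamilyOver.unique p hd (V.isKummerFamilyOver_kummerFamily p H' _)

/-- **THE COMPACT KUMMER MAP** `E(L') → ∏_k H¹(H', E[p^k])`, `P ↦ (δ(P))_k`, as an additive
homomorphism on the `H'`-fixed points (additivity `IsKummerFamilyOver.add`, `isKummerFamilyOver_zero`,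
uniqueness). Perrin-Riou 1987 §0 / Howard 2004 §1: the compact Kummer map `E(L) ⊗ ℤ_p ↪ S_p(E/L)`.
[cite: Howard2004HeegnerKolyvagin, §1 (descent sequence for S_p(E/L))] [cite: PerrinRiou1987BSMF, §0 p. 401] -/
def kummerFamilyHom [V.IsElliptic] : V.fixedGeomPoints H' →+ V.torsionH1Pi p H' where
  toFun := V.kummerFamily p H'
  map_zero' :=
    IsKummerFamilyOver.unique p (V.isKummerFamilyOver_kummerFamily p H' 0)
      (V.isKummerFamilyOver_zero (p := p) (H' := H'))
  map_add' P P' :=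
    IsKummerFamilyOver.unique p (V.isKummerFamilyOver_kummerFamily p H' (P + P'))
      (IsKummerFamilyOver.add p (V.isKummerFamilyOver_kummerFamily p H' P)
        (V.isKummerFamilyOver_kummerFamily p H' P'))

/-- Unfolding `kummerFamilyHom`. [cite: Howard2004HeegnerKolyvagin, §1 (descent sequence for S_p(E/L))] -/
@[simp]
theorem kummerFamilyHom_apply [V.IsElliptic] (P : V.fixedGeomPoints H') :
    V.kummerFamilyHom p H' P = V.kummerFamily p H' P :=
  rfl

/-- **Kernel of the compact Kummer map at level `k`**: `(kummerFamily P)_k = 0 ↔ P ∈ p^k • E(L')`.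
[cite: SilvermanAEC2009, VIII.§2 (the Kummer sequence)] -/
theorem kummerFamily_apply_eq_zero_iff [V.IsElliptic] (P : V.fixedGeomPoints H') (k : ℕ) :
    V.kummerFamily p H' P k = 0 ↔ ∃ R : V.fixedGeomPoints H', ((p : ℤ) ^ k) • R = P := by
  have hpk : ((p : ℤ) ^ k) ≠ 0 := pow_ne_zero _ (Int.natCast_ne_zero.mpr (Fact.out : p.Prime).ne_zero)
  obtain ⟨Q, hQ⟩ := V.zsmul_geomPoints_surjective_holds hpk (P : geomPoints V)
  have hQ' : ((p : ℤ) ^ k) • Q = (P : geomPoints V) := hQ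
  rw [V.isKummerFamilyOver_kummerFamily p H' P k Q hQ', kummerClassOver_eq_zero_iff]
  constructor
  · rintro ⟨R, hRfix, hR⟩
    refine ⟨⟨R, (V.mem_fixedGeomPoints_iff R).2 hRfix⟩, Subtype.ext ?_⟩
    rw [AddSubgroupClass.coe_zsmul]
    exact hR.trans hQ'
  · rintro ⟨R, hR⟩
    refine ⟨R, (V.mem_fixedGeomPoints_iff _).1 R.2, ?_⟩
    rw [hQ', ← hR, AddSubgroupClass.coe_zsmul]

/-- **The Kummer span of a set of fixed points is the `ℤ_p`-span of their Kummer families**: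
`kummerSpan S = closure {c • kummerFamily P : P ∈ S, c ∈ ℤ_p}`. [cite: Howard2004HeegnerKolyvagin, §1 (descent sequence for S_p(E/L))] -/
theorem kummerSpan_eq_closure_kummerFamily [V.IsElliptic] (S : Set (geomPoints V))
    (hS : ∀ P ∈ S, ∀ σ ∈ H', σ • P = P) :
    V.kummerSpan p H' S hS =
      AddSubgroup.closure {x | ∃ (P : geomPoints V) (hPS : P ∈ S) (c : ℤ_[p]),
        x = V.padicPi p H' c (V.kummerFamily p H' ⟨P, (V.mem_fixedGeomPoints_iff P).2 (hS P hPS)⟩)} := by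
  unfold kummerSpan
  congr 1
  ext x
  constructor
  · rintro ⟨P, hPS, c, d, hd, rfl⟩
    exact ⟨P, hPS, c, by rw [IsKummerFamilyOver.eq_kummerFamily p (hS P hPS) hd]⟩
  · rintro ⟨P, hPS, c, rfl⟩
    exact ⟨P, hPS, c, _, V.isKummerFamilyOver_kummerFamily p H' _, rfl⟩

end KummerFamilyHom

end WeierstrassCurve

end
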